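import Literature.MathematicalPhysics.QuantumFieldTheory.Balaban1983to89.T4NestedShells

/-!
# `Balaban1983to89.T4ShellCount` — the COMBINATORIAL / LOWERED-THRESHOLD ("count × suppression") route to the
single-run shell-weight bound NE7c (`T4IndicatorShell.ShellWeightBound`): what it proves, where it stops, and the exact
missing inequality (cell `pub-balaban`, T4-DAG v15 §6 NE7c / §5 row T4-U5b.E2; records `t4/T4-EST-U5bE2.md` v1.1 §0(c)
(H-sh-2) and §3 S1–S4, `t4/T4-EST-NE7c-P2.md`; kernel siblings `T4IndicatorShell` (the target structure and the shell
indicators), `T4NestedShells` §4 (`shellWeightBound_of_levels`), `T4BookingNecessity` §4 (no size-only booking on the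
log window), `T4ShellMeasure` (the sibling SHELL-MEASURE route))

HONEST FRAMING (cell `pub-balaban`, T4-DAG PAGE 1).  The cell's T4 target is rung (B)+1: existence AND uniqueness of the
`ε → 0` limit of Bałaban's unit-scale averaged loop expectations on a FIXED finite torus — strictly beyond ultraviolet
stability ([Balaban1989LargeFieldII] Thm 1 p. 355), NOT infinite volume, NOT a mass gap, NOT the Clay problem.  The
estimate NE7c compares nothing that is printed: the manuscripts under audit construct ONE run of the renormalization
group and bound its terms uniformly in `ε`; the two-run threshold SHELLS exist only in the cell's matching scheme (node
U5, design (i) "common refinement" of `T4IndicatorShell`).  NOTHING below is an estimate about Bałaban's objects: every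
`def … : Prop` is a HYPOTHESIS SHAPE labelled PRINTED-SHAPE or NOT PRINTED, and every `theorem` is [folklore] indicator /
finite-sum / `tsum` arithmetic with the standard axioms.  The couplings never enter this file; where the cell instantiates
the per-age suppression numbers `s a = exp(−p a)` by Bałaban's `exp(−p₀(g_{K−a}))` it does so under its explicit
conditionals (BetaPertH, (B), (B^μ), the synchronisation U5a) in the records, not here.

THE ROUTE (T4-EST-U5bE2 §3).  S1: on the shell below a small-field threshold `θ` of relative width `ρ`, the slot's OWN
tested variable is `≥ (1 − ρ)θ` — a large-field event OF THE SAME RUN at the lowered threshold, which carries that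
threshold's exponential small factor ([Balaban1989LargeFieldI] p. 193, the mechanism of `1 − χ_{k,Λ}`).  S2: COUNT the
shell-bearing slots of a final-scale term per scale.  S3: SUM count × suppression over the slots and over `K`.  S4:
package as `ShellWeightBound`.  This file executes S1 exactly (§1), types the ledger S2–S3 produce (§2, the AGE LEDGER:
the weight shape of `T4NestedShells.shellWeightBound_of_levels` with the level set re-indexed by AGE `a = K − j ∈ [0, N]`
over the printed BOUNDED live window), and proves about that ledger:
* NECESSITY (§2): summability of the assembled weight `K ↦ Σ_{a ≤ N} m_a · x_a(K)` forces the per-slot ratio `x_a(K)`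
  of EVERY counted age to be summable in `K`, in particular to tend to `0` (`summable_slot_of_summable_ageWeight`,
  `tendsto_zero_slot_of_summable_ageWeight`); a per-slot ratio bounded BELOW at one counted age by a positive constant
  along infinitely many `K` kills summability (`not_summable_ageWeight_of_frequently_le`), and AGE-ONLY ratios
  `x_a(K) = s(a)` — which is exactly what a `K`-independent lowered-threshold suppression factor is — make the weight
  EVENTUALLY CONSTANT, equal to the count × suppression number `C₀ = Σ_{a ≤ N} m_a s(a)` (`ageWeight_eq_C0_of_ageOnly`,
  `not_summable_ageWeight_of_ageOnly`).  THIS IS THE WALL OF THE ROUTE (S3 does not follow): the shell-bearing slots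
  are YOUNG (ages `≤ N`, the final-scale slot of age `0` present in every term), their printed suppression and their
  count are functions of the AGE alone (IR-anchored), so the route's certificate is the constant `C₀ > 0`, never a
  summable sequence — in agreement with `T4BookingNecessity.not_summable_exp_neg_p0Profile_select` (pv06) for the
  `p₀`-profile shape on the log window.
* WHAT THE ROUTE DOES GIVE (§2): the UNIFORM budget `Wsh_K ≤ C₀` for all `K` (`ageWeight_le_C0`) — it serves only the
  early-`K` part of the smallness condition `W_K + Wsh_K < 1` (H-sh-4), never the field `ShellWeightBound.summable`.
* SUFFICIENCY WITH A LEVEL-ANCHORED GAIN, AND THE EXACT BOOKING TOTAL (§3): if the per-slot ratio factorises as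
  `x_a(K) ≤ s(a) · y(K − a)` with `y` indexed by the LEVEL `j = K − a` (UV-anchored) and summable, the weight is
  summable (`summable_ageWeight_of_levelGain`) and the clean band majorant has total EXACTLY
  `Σ_K Σ_{a ≤ N, a ≤ K} m_a s(a) y(K − a) = C₀ · Σ_j y(j)` (`tsum_bandMajorant`: Fubini on the band `K − N ≤ j ≤ K` —
  every level is live in exactly `N + 1` consecutive runs): ANY summable level gain suffices, no geometric rate is
  needed, and the window entropy inside `C₀` is paid once, not per `K`.  The only UV-anchored quantity a slot carries is
  the two-run WIDTH `ρ_j` of the closeness hypothesis (F∞) (NOT PRINTED, NE3 species) — converting it into a ratio gain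
  is the sibling SHELL-MEASURE route (`T4ShellMeasure`), not this one.  §4 is the end-to-end constructor
  `shellWeightBound_of_ageLedger` into the literal `T4IndicatorShell.ShellWeightBound` (via
  `T4NestedShells.shellWeightBound_of_levels`), §5 the printed-shape instantiation `m_a ≤ V·Λ^a`, `s(a) = exp(−p a)`.

CITATION HEADER (LOCATORS + the sentences this seat read on the rendered pages of the cell's page store
`b2b-balaban-ref1/pages/…` AS IMAGES on 2026-08-19; NOTHING below is used as a hypothesis of a theorem, and the audited
manuscripts are not cited for any disputed step — the shapes are CONTEXT for the hypothesis names).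
* [Balaban1989LargeFieldI] T. Bałaban, *Large field renormalization. I. The basic step of the R operation*, Commun.
  Math. Phys. 122 (1989) 175–202.  p. 178, (1.2) `𝕋_k(Z) exp A_k = χ_k(Ω_k^{~4}) ∏_{j=k−1}^{h} 𝕋^{(j)}(Z_{j+1})
  χ_h(Ω∖Ω^~_{h+1}) 𝕋_h(Z_h) exp A_k` «where h = k − N, and we have written explicitly the first and the last
  characteristic functions in the product of the last N one-step operations»; p. 178 «The cubes □ in (1.3) are the
  LM₂R_j-cubes of the partition of the lattice T_{L^{−j}}, or the L^{−(k−j)}LM₂R_j-cubes of the lattice T_η»; p. 179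
  «We assume that N > N₀, in fact it will become clear later that N is much greater than N₀»; p. 198, after (1.94):
  «The last inequality holds under two restrictions on N. At first, we assume that N ≤ O(1)(log g_k^{−2})^ν … The second
  is that N has to be sufficiently large … These two conditions can be satisfied by N to the positive power of
  log g_k^{−2}» — THE LIVE WINDOW OF EXPLICIT CHARACTERISTIC FUNCTIONS IS BOUNDED BY `N = N(g_k)`, a function of the
  coupling at the CURRENT step (at the final step, of the renormalised coupling: `K`-independent under the cell's U5a);
  p. 193 «On the other hand, for any extension we have |∂U_{k,Z} − 1| ≥ 2ε_kη², hence 2ε_k < O(1)B₃M²ε, and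
  |V_k(∂p′) − 1| > (O(1)B₃M²)^{−1}ε_k for some p′ ⊂ Z∩Λᶜ. This condition is enough to get the exponential small factor,
  estimating in the usual way the Wilson action. Thus 1 − χ_{k,Λ} is a large field function» (the S1 template) and
  «All the above transformations preserve the k^{th} density ρ_k, they change only the representation of this density.»
* [Balaban1988Convergent] T. Bałaban, *Convergent renormalization expansions for lattice gauge theories*, Commun. Math.
  Phys. 119 (1988) 243–285.  p. 257, (2.17) `χ_k(Ω_k) = ∏_{□ ⊂ Ω_k} χ({sup_{p ⊂ □~}|U_{k,□}(V_k, ∂p) − 1| < ε_kη²})`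
  «where the cubes □ belong to the partition of the lattice T_η into cubes of the size LM₂R_k»; (2.18) the density as a
  sum over admissible sequences of domains — THE COUNT: one small-field slot per LM₂R-cube per live level.
* [Balaban1989LargeFieldII] T. Bałaban, *Large field renormalization. II*, Commun. Math. Phys. 122 (1989) 355–392.
  p. 383, (1.79): the one-run bound `𝐓′_k(X)1 ≤ sup exp{Σ_j O(1)M^dR_j^{d+1}d′_j(Z_j)} · ∏_j ∏_i exp(−½γ₀A₁²p₀²(g_j)
  (d′_j(Z_j^{(i)}) + 1) − 2p₀(g_j)) ∏′ exp(−p₀(g_j))` «where the last product is over components of Z_j … for which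
  some large fields are created during the preparatory steps», and «the summations over the admissible sequences can
  be replaced by the factors exp O(1)(MR_j)^{−d}|Z_j|» — THE PRINTED PER-REGION SUPPRESSION AND ENTROPY, both indexed by
  the coupling `g_j` of the creation step, i.e. by AGE in a run whose final coupling is renormalised.
The reading record with the slot census per kind (which characteristic functions are background-mediated: kinds A1–A3,
A6, A7, A9, B5, B11, B15) is `t4/T4-XREAD-U5X15.md` §2 (cell-internal analysis, not a citation).
Unit `b2b-balaban-t4-ne7c-p2` (journal CLAIM T4-U5b.E2-NE7c-PROVE-P2* 2026-08-19T07:05:58Z). [folklore arithmetic]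
-/

noncomputable section

open Finset _root_.Filter _root_.Topology

namespace Literature.MathematicalPhysics.QuantumFieldTheory.Balaban1983to89.T4ShellCount

open T4IndicatorShell T4NestedShells

/-! ## §1 S1 exactly: a shell is a same-run large-field event at the lowered threshold, cut by the slot's own function -/

section S1

/-- **S1 (below).**  The shell of width `Δ` below the threshold `θ` IS the large-field event at the LOWERED threshold
`θ − Δ` intersected with the small-field event at `θ`: `1[θ − Δ ≤ u < θ] = 1[θ − Δ ≤ u] · 1[u < θ]` — the kernel form of
T4-EST-U5bE2 §3 S1 / [Balaban1989LargeFieldI] p. 193 «Thus 1 − χ_{k,Λ} is a large field function» read at the lowered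
threshold. [folklore] -/
theorem shellBelow_eq_largeInd_mul_smallInd (u θ Δ : ℝ) :
    shellBelow u θ Δ = largeInd u (θ - Δ) * smallInd u θ := by
  unfold shellBelow largeInd smallInd
  by_cases h1 : θ - Δ ≤ u <;> by_cases h2 : u < θ <;> simp [h1, h2]

/-- **S1 (above).**  The shell of width `Δ` above a large-field threshold `θ` is the large-field event at `θ` itself cut
by the small-field event at `θ + Δ`. [folklore] -/
theorem shellAbove_eq_largeInd_mul_smallInd (u θ Δ : ℝ) :
    shellAbove u θ Δ = largeInd u θ * smallInd u (θ + Δ) := by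
  unfold shellAbove largeInd smallInd
  by_cases h1 : θ ≤ u <;> by_cases h2 : u < θ + Δ <;> simp [h1, h2]

/-- Hence the shell below `θ` is dominated by the large-field indicator at the lowered threshold (the domination the
count × suppression route books; it is BLIND TO THE WIDTH `Δ` except through the threshold value). [folklore] -/
theorem shellBelow_le_largeInd (u θ Δ : ℝ) : shellBelow u θ Δ ≤ largeInd u (θ - Δ) := by
  rw [shellBelow_eq_largeInd_mul_smallInd]
  exact mul_le_of_le_one_right (largeInd_nonneg _ _) (smallInd_le_one _ _)

/-- … and the shell above `θ` by the large-field indicator at `θ`. [folklore] -/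
theorem shellAbove_le_largeInd (u θ Δ : ℝ) : shellAbove u θ Δ ≤ largeInd u θ := by
  rw [shellAbove_eq_largeInd_mul_smallInd]
  exact mul_le_of_le_one_right (largeInd_nonneg _ _) (smallInd_le_one _ _)

/-- Relative-width form (the cell's `Δ = ρθ`): the shell below `θ` lies in the large-field event at `(1 − ρ)θ`.
[folklore] -/
theorem shellBelow_rel_le_largeInd (u θ ρ : ℝ) : shellBelow u θ (ρ * θ) ≤ largeInd u ((1 - ρ) * θ) := by
  have e : θ - ρ * θ = (1 - ρ) * θ := by ring
  rw [← e]
  exact shellBelow_le_largeInd u θ (ρ * θ)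

/-- Lowering a large-field threshold enlarges the event (monotone slack). [folklore] -/
theorem largeInd_antitone {u θ θ' : ℝ} (h : θ' ≤ θ) : largeInd u θ ≤ largeInd u θ' := by
  unfold largeInd
  by_cases h1 : θ ≤ u
  · have h2 : θ' ≤ u := h.trans h1
    simp [h1, h2]
  · simp only [h1, if_false]
    split_ifs <;> norm_num

/-- So a uniform width bound `Δ ≤ Δ₀` costs only the threshold `θ − Δ₀`: every shell of width `≤ Δ₀` below `θ` lies in
ONE `K`-independent large-field event — the precise sense in which the route cannot see a `K`-dependent width.
[folklore] -/
theorem shellBelow_le_largeInd_of_width_le {u θ Δ Δ₀ : ℝ} (h : Δ ≤ Δ₀) :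
    shellBelow u θ Δ ≤ largeInd u (θ - Δ₀) :=
  (shellBelow_le_largeInd u θ Δ).trans (largeInd_antitone (by linarith))

end S1

/-! ## §2 The AGE LEDGER of the route: necessity, the wall, and the uniform budget -/

section AgeLedger

/-- THE AGE-LEDGER WEIGHT the count × suppression route assembles at run `K`: ages `a = 0, …, N` (the BOUNDED live
window `h = k − N … k` of [Balaban1989LargeFieldI] (1.2) p. 178, `N = N(g_k)` inside the window after (1.94) p. 198 —
at the final step a function of the renormalised coupling, `K`-independent under U5a), multiplicity `m a` of the age-`a`
slots (cube counts, §5), per-slot shell RATIO `x a K` (total shell piece of the slot over the run's total weight).  This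
is the weight `K ↦ Σ_ℓ m_ℓ · w_ℓ K` of `T4NestedShells.shellWeightBound_of_levels` with the level set indexed by age.
(bookkeeping shape) [folklore] -/
def ageWeight (N : ℕ) (m : ℕ → ℝ) (x : ℕ → ℕ → ℝ) (K : ℕ) : ℝ := ∑ a ∈ range (N + 1), m a * x a K

variable {N : ℕ} {m s : ℕ → ℝ} {x : ℕ → ℕ → ℝ}

/-- `a ∈ range (N+1) ↔ a ≤ N`. [folklore] -/
theorem mem_range_succ_iff {a N : ℕ} : a ∈ range (N + 1) ↔ a ≤ N := by
  rw [mem_range, Nat.lt_succ_iff]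

/-- NECESSITY, TOTAL: a shell-weight bound forces its weight to tend to `0`. [folklore] -/
theorem tendsto_zero_of_shellWeightBound {ι : Type*} {l₀ : ℝ} {T : ℕ → Finset ι}
    {A B shA shB : ℕ → ℝ → ι → ℝ} {Wsh : ℕ → ℝ} (h : ShellWeightBound l₀ T A B shA shB Wsh) :
    Tendsto Wsh atTop (𝓝 0) :=
  h.summable.tendsto_atTop_zero

/-- NECESSITY, PER SLOT, SHARPEST FORM: a shell bound with a `K`-INDEPENDENT weight is trivial —
`ShellWeightBound … (fun _ => c)` forces `c = 0`.  So an AGE-ONLY per-slot bound (a fixed number, e.g. a lowered-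
threshold suppression factor `exp(−p₀′(ḡ_a))`) cannot even be FED to `T4NestedShells.shellWeightBound_of_levels`,
whose slots each carry their own `ShellWeightBound`. [folklore] -/
theorem weight_const_eq_zero {ι : Type*} {l₀ : ℝ} {T : ℕ → Finset ι} {A B shA shB : ℕ → ℝ → ι → ℝ} {c : ℝ}
    (h : ShellWeightBound l₀ T A B shA shB (fun _ => c)) : c = 0 :=
  (summable_const_iff c).1 h.summable

/-- NECESSITY, PER SLOT: if the age-ledger weight is summable (all entries non-negative), then the per-slot ratio of
EVERY counted age with positive multiplicity is itself summable in `K` … [folklore] -/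
theorem summable_slot_of_summable_ageWeight (hm : ∀ a ≤ N, 0 ≤ m a) (hx : ∀ a ≤ N, ∀ K, 0 ≤ x a K)
    (hs : Summable (ageWeight N m x)) {a₀ : ℕ} (ha₀ : a₀ ≤ N) (hm₀ : 0 < m a₀) :
    Summable (x a₀) := by
  have h1 : Summable (fun K => m a₀ * x a₀ K) := by
    refine hs.of_nonneg_of_le (fun K => mul_nonneg hm₀.le (hx a₀ ha₀ K)) (fun K => ?_)
    exact single_le_sum (f := fun a => m a * x a K)
      (fun a ha => mul_nonneg (hm a (mem_range_succ_iff.1 ha)) (hx a (mem_range_succ_iff.1 ha) K))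
      (mem_range_succ_iff.2 ha₀)
  have h2 := h1.mul_left (m a₀)⁻¹
  simpa [inv_mul_cancel_left₀ hm₀.ne'] using h2

/-- … in particular it TENDS TO `0` as `K → ∞`: no `K`-independent per-slot bound can be the last word at any counted
age. [folklore] -/
theorem tendsto_zero_slot_of_summable_ageWeight (hm : ∀ a ≤ N, 0 ≤ m a) (hx : ∀ a ≤ N, ∀ K, 0 ≤ x a K)
    (hs : Summable (ageWeight N m x)) {a₀ : ℕ} (ha₀ : a₀ ≤ N) (hm₀ : 0 < m a₀) :
    Tendsto (x a₀) atTop (𝓝 0) :=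
  (summable_slot_of_summable_ageWeight hm hx hs ha₀ hm₀).tendsto_atTop_zero

/-- A real sequence which is `≥ c > 0` along infinitely many indices is not summable. [folklore] -/
theorem not_summable_of_frequently_le {f : ℕ → ℝ} {c : ℝ} (hc : 0 < c) (h : ∃ᶠ K in atTop, c ≤ f K) :
    ¬ Summable f := by
  intro hf
  have hlt : ∀ᶠ K in atTop, f K < c := hf.tendsto_atTop_zero.eventually (gt_mem_nhds hc)
  exact (h.and_eventually hlt).exists.elim fun K hK => absurd hK.1 (not_le.2 hK.2)

/-- **THE WALL, GENERAL FORM.**  If at ONE counted age `a₀` (positive multiplicity) the per-slot shell ratio stays above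
a positive constant `s₀` along infinitely many `K` — as it does whenever the only available bound is a `K`-independent
number and that number is attained in order of magnitude — the age-ledger weight is NOT summable. [folklore] -/
theorem not_summable_ageWeight_of_frequently_le (hm : ∀ a ≤ N, 0 ≤ m a) (hx : ∀ a ≤ N, ∀ K, 0 ≤ x a K)
    {a₀ : ℕ} (ha₀ : a₀ ≤ N) (hm₀ : 0 < m a₀) {s₀ : ℝ} (hs₀ : 0 < s₀) (h : ∃ᶠ K in atTop, s₀ ≤ x a₀ K) :
    ¬ Summable (ageWeight N m x) := by
  refine not_summable_of_frequently_le (mul_pos hm₀ hs₀) (h.mono fun K hK => ?_)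
  calc m a₀ * s₀ ≤ m a₀ * x a₀ K := mul_le_mul_of_nonneg_left hK hm₀.le
    _ ≤ ageWeight N m x K := single_le_sum (f := fun a => m a * x a K)
        (fun a ha => mul_nonneg (hm a (mem_range_succ_iff.1 ha)) (hx a (mem_range_succ_iff.1 ha) K))
        (mem_range_succ_iff.2 ha₀)

/-- THE COUNT × SUPPRESSION NUMBER `C₀ = Σ_{a ≤ N} m_a · s(a)` (count per age × per-slot suppression at that age).
(bookkeeping shape) [folklore] -/
def C0 (N : ℕ) (m s : ℕ → ℝ) : ℝ := ∑ a ∈ range (N + 1), m a * s a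

/-- `C₀ ≥ 0`. [folklore] -/
theorem C0_nonneg (hm : ∀ a ≤ N, 0 ≤ m a) (hs : ∀ a ≤ N, 0 ≤ s a) : 0 ≤ C0 N m s :=
  sum_nonneg fun a ha => mul_nonneg (hm a (mem_range_succ_iff.1 ha)) (hs a (mem_range_succ_iff.1 ha))

/-- `C₀ > 0` as soon as one counted age has `m_a · s(a) > 0`. [folklore] -/
theorem C0_pos (hm : ∀ a ≤ N, 0 ≤ m a) (hs : ∀ a ≤ N, 0 ≤ s a) {a₀ : ℕ} (ha₀ : a₀ ≤ N) (h0 : 0 < m a₀ * s a₀) :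
    0 < C0 N m s :=
  lt_of_lt_of_le h0 (single_le_sum (f := fun a => m a * s a)
    (fun a ha => mul_nonneg (hm a (mem_range_succ_iff.1 ha)) (hs a (mem_range_succ_iff.1 ha))) (mem_range_succ_iff.2 ha₀))

/-- **THE WALL, AGE-ONLY FORM (S3 of the route does not follow).**  AGE-ONLY per-slot ratios — `x a K = s a` as soon
as the level `K − a` exists (`a ≤ K`), which is what a lowered-threshold suppression factor indexed by the coupling of
the creation step gives in a run with renormalised final coupling — make the age-ledger weight EVENTUALLY CONSTANT,
equal to `C₀`, from `K = N` on … [folklore] -/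
theorem ageWeight_eq_C0_of_ageOnly (hxs : ∀ a K, a ≤ K → x a K = s a) {K : ℕ} (hK : N ≤ K) :
    ageWeight N m x K = C0 N m s := by
  unfold ageWeight C0
  refine sum_congr rfl fun a ha => ?_
  rw [hxs a K ((mem_range_succ_iff.1 ha).trans hK)]

/-- … hence it is NOT SUMMABLE as soon as one counted age has `m_a · s(a) > 0` (the final-scale slot: age `0`,
multiplicity = the number of final cubes `≥ 1`, suppression `exp(−p) > 0`).  The route's certificate is the constant
`C₀`, never a summable sequence; cf. `T4BookingNecessity.not_summable_exp_neg_p0Profile_select` for the `p₀`-profile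
shape on the log window. [folklore] -/
theorem not_summable_ageWeight_of_ageOnly (hxs : ∀ a K, a ≤ K → x a K = s a) (hm : ∀ a ≤ N, 0 ≤ m a)
    (hs : ∀ a ≤ N, 0 ≤ s a) {a₀ : ℕ} (ha₀ : a₀ ≤ N) (h0 : 0 < m a₀ * s a₀) :
    ¬ Summable (ageWeight N m x) := by
  refine not_summable_of_frequently_le (C0_pos hm hs ha₀ h0) (Eventually.frequently ?_)
  filter_upwards [eventually_ge_atTop N] with K hK
  rw [ageWeight_eq_C0_of_ageOnly hxs hK]

/-- **WHAT THE ROUTE DOES GIVE: THE UNIFORM BUDGET.**  Per-slot ratios bounded by age-only numbers `s(a)` (the lowered-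
threshold suppression) give `Wsh_K ≤ C₀` for EVERY `K` — a `K`-independent budget, serving the early-`K` part of the
smallness condition `W_K + Wsh_K < 1` (H-sh-4) and nothing else. [folklore] -/
theorem ageWeight_le_C0 (hm : ∀ a ≤ N, 0 ≤ m a) (hxs : ∀ a ≤ N, ∀ K, x a K ≤ s a) (K : ℕ) :
    ageWeight N m x K ≤ C0 N m s :=
  sum_le_sum fun a ha => mul_le_mul_of_nonneg_left (hxs a (mem_range_succ_iff.1 ha) K) (hm a (mem_range_succ_iff.1 ha))

/-- The smallness service spelled out: if the bad-class weight obeys `W_K ≤ W̄` and `C₀ < 1 − W̄`, then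
`W_K + Wsh_K < 1` for EVERY `K` (no early-`K` exceptions) for any shell weight under the uniform budget. [folklore] -/
theorem lt_one_of_C0 {W Wsh : ℕ → ℝ} {Wbar : ℝ} (hW : ∀ K, W K ≤ Wbar) (hWsh : ∀ K, Wsh K ≤ C0 N m s)
    (hC : C0 N m s < 1 - Wbar) (K : ℕ) : W K + Wsh K < 1 := by
  have h1 := hW K
  have h2 := hWsh K
  linarith

end AgeLedger

/-! ## §3 Sufficiency with a LEVEL-anchored gain, and the exact booking total (Fubini on the band) -/

section LevelGain

variable {N : ℕ} {m s y : ℕ → ℝ} {x : ℕ → ℕ → ℝ}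

/-- Shifted summability: `K ↦ y(K − a)` (truncated subtraction) is summable when `y` is. [folklore] -/
theorem summable_shift_tsub (hy : Summable y) (a : ℕ) : Summable (fun K => y (K - a)) := by
  refine (summable_nat_add_iff a).1 ?_
  simpa using hy

/-- **SUFFICIENCY.**  If the per-slot ratio of every counted age factorises as (age-only number) × (a gain indexed by
the LEVEL `j = K − a`), `0 ≤ x a K ≤ s(a) · y(K − a)`, with `y` summable, then the age-ledger weight is summable —
for ANY summable `y` (no geometric rate needed).  The gain `y` is NOT PRINTED (the only level-anchored quantity of a
slot is the two-run width of (F∞); turning it into a ratio gain is the sibling SHELL-MEASURE route). [folklore] -/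
theorem summable_ageWeight_of_levelGain (hm : ∀ a ≤ N, 0 ≤ m a) (hx0 : ∀ a ≤ N, ∀ K, 0 ≤ x a K)
    (hx : ∀ a ≤ N, ∀ K, x a K ≤ s a * y (K - a)) (hy : Summable y) :
    Summable (ageWeight N m x) := by
  refine summable_sum fun a ha => ?_
  have ha' := mem_range_succ_iff.1 ha
  have hmaj : Summable (fun K => m a * (s a * y (K - a))) :=
    ((summable_shift_tsub hy a).mul_left (s a)).mul_left (m a)
  exact hmaj.of_nonneg_of_le (fun K => mul_nonneg (hm a ha') (hx0 a ha' K))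
    (fun K => mul_le_mul_of_nonneg_left (hx a ha' K) (hm a ha'))

/-- … with the bound `Σ_K Wsh_K ≤ Σ_K Σ_{a ≤ N} m_a s(a) y(K − a)`. [folklore] -/
theorem tsum_ageWeight_le_of_levelGain (hm : ∀ a ≤ N, 0 ≤ m a) (hx0 : ∀ a ≤ N, ∀ K, 0 ≤ x a K)
    (hx : ∀ a ≤ N, ∀ K, x a K ≤ s a * y (K - a)) (hy : Summable y) :
    ∑' K, ageWeight N m x K ≤ ∑' K, ∑ a ∈ range (N + 1), m a * (s a * y (K - a)) := by
  refine Summable.tsum_le_tsum (fun K => sum_le_sum fun a ha => ?_) (summable_ageWeight_of_levelGain hm hx0 hx hy)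
    (summable_sum fun a _ => ((summable_shift_tsub hy a).mul_left (s a)).mul_left (m a))
  exact mul_le_mul_of_nonneg_left (hx a (mem_range_succ_iff.1 ha) K) (hm a (mem_range_succ_iff.1 ha))

/-- THE CLEAN BAND MAJORANT: age-`a` slots exist only in runs with `K ≥ a` (the level `K − a` must exist), so the
majorant charges `m_a s(a) y(K − a)` exactly on the band `0 ≤ K − a`, i.e. on the levels `j = K − a ∈ [K − N, K]`.
(bookkeeping shape) [folklore] -/
def bandMajorant (N : ℕ) (m s y : ℕ → ℝ) (K : ℕ) : ℝ :=
  ∑ a ∈ range (N + 1), if a ≤ K then m a * s a * y (K - a) else 0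

/-- one age strip of the band is a shifted copy of `y`, hence summable … [folklore] -/
theorem summable_bandTerm (hy : Summable y) (a : ℕ) :
    Summable (fun K => if a ≤ K then m a * s a * y (K - a) else 0) := by
  refine (summable_nat_add_iff a).1 ?_
  simpa using hy.mul_left (m a * s a)

/-- … with total EXACTLY `m_a s(a) · Σ_j y(j)` (the level `j` is charged once in the strip, at `K = j + a`).
[folklore] -/
theorem tsum_bandTerm (hy : Summable y) (a : ℕ) :
    ∑' K, (if a ≤ K then m a * s a * y (K - a) else 0) = m a * s a * ∑' j, y j := by
  rw [← (summable_bandTerm (m := m) (s := s) hy a).sum_add_tsum_nat_add a]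
  have h0 : ∑ i ∈ range a, (if a ≤ i then m a * s a * y (i - a) else 0) = 0 :=
    sum_eq_zero fun i hi => if_neg (not_le.2 (mem_range.1 hi))
  rw [h0, zero_add]
  simp [tsum_mul_left]

/-- the band majorant is summable in `K`. [folklore] -/
theorem summable_bandMajorant (hy : Summable y) : Summable (bandMajorant N m s y) :=
  summable_sum fun a _ => summable_bandTerm hy a

/-- **THE EXACT BOOKING TOTAL (Fubini on the band `K − N ≤ j ≤ K`).**  `Σ_K bandMajorant_K = C₀ · Σ_j y(j)`: every
level `j` is live in exactly the `N + 1` consecutive runs `K = j, …, j + N`, with total multiplicity-weighted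
suppression `C₀`; so the window entropy hidden in `C₀` (the `Λ^a` of the cube counts) is paid ONCE, not per `K`, and
NE7c costs exactly `C₀ ×` (the total level gain). [folklore] -/
theorem tsum_bandMajorant (hy : Summable y) :
    ∑' K, bandMajorant N m s y K = C0 N m s * ∑' j, y j := by
  unfold bandMajorant C0
  rw [Summable.tsum_finsetSum (fun a _ => summable_bandTerm hy a), sum_mul]
  exact sum_congr rfl fun a _ => tsum_bandTerm hy a

/-- The band majorant dominates the age-ledger weight when the ratios vanish off the band (no slot of age `a > K`)
and factorise on it. [folklore] -/
theorem ageWeight_le_bandMajorant (hm : ∀ a ≤ N, 0 ≤ m a)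
    (hoff : ∀ a ≤ N, ∀ K, K < a → x a K ≤ 0) (hx : ∀ a ≤ N, ∀ K, a ≤ K → x a K ≤ s a * y (K - a)) (K : ℕ) :
    ageWeight N m x K ≤ bandMajorant N m s y K := by
  refine sum_le_sum fun a ha => ?_
  have ha' := mem_range_succ_iff.1 ha
  split_ifs with hK
  · rw [mul_assoc]; exact mul_le_mul_of_nonneg_left (hx a ha' K hK) (hm a ha')
  · exact (mul_le_mul_of_nonneg_left (hoff a ha' K (not_le.1 hK)) (hm a ha')).trans_eq (mul_zero _)

/-- Hence, on the band, `Σ_K Wsh_K ≤ C₀ · Σ_j y(j)`. [folklore] -/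
theorem tsum_ageWeight_le_C0_mul (hm : ∀ a ≤ N, 0 ≤ m a) (hx0 : ∀ a ≤ N, ∀ K, 0 ≤ x a K)
    (hoff : ∀ a ≤ N, ∀ K, K < a → x a K ≤ 0) (hx : ∀ a ≤ N, ∀ K, a ≤ K → x a K ≤ s a * y (K - a))
    (hy : Summable y) :
    ∑' K, ageWeight N m x K ≤ C0 N m s * ∑' j, y j := by
  rw [← tsum_bandMajorant hy]
  have hle : ∀ K, ageWeight N m x K ≤ bandMajorant N m s y K := ageWeight_le_bandMajorant hm hoff hx
  have h0 : ∀ K, 0 ≤ ageWeight N m x K := fun K =>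
    sum_nonneg fun a ha => mul_nonneg (hm a (mem_range_succ_iff.1 ha)) (hx0 a (mem_range_succ_iff.1 ha) K)
  exact Summable.tsum_le_tsum hle ((summable_bandMajorant hy).of_nonneg_of_le h0 hle) (summable_bandMajorant hy)

end LevelGain

/-! ## §4 The constructor: an age ledger with a level gain IS a `T4IndicatorShell.ShellWeightBound` -/

section Constructor

variable {ι : Type*} {l₀ : ℝ} {T : ℕ → Finset ι} {A B : ℕ → ℝ → ι → ℝ}

/-- THE AGE LEDGER OF ONE RUN (hypothesis shape; NOT PRINTED — NE7c species, cf. `T4ShellMeasure.SlotLedger` of the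
sibling route for the level-indexed form): slots `σ = ⟨a, i⟩`, age `a ≤ N`, copy `i < n a` (`n a` = the number of age-`a`
slots, a CUBE COUNT, §5); slot `σ` has a shell piece `shXs σ` with `0 ≤ shXs σ ≤` the term weight (the piece is cut out
of the FULL run — single-run species, no object of the other run inside, `T4IndicatorShell.shellPiece_mul_le_shell_mul_
term`), and its total is at most `x a K ×` the run's total weight — the per-slot shell RATIO, shared by the slots of
one age (same kind, same synchronised threshold). (hypothesis shape, NOT PRINTED) [folklore] -/
structure AgeLedger (l₀ : ℝ) (T : ℕ → Finset ι) (X : ℕ → ℝ → ι → ℝ) (N : ℕ) (n : ℕ → ℕ)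
    (shXs : (Σ _ : ℕ, ℕ) → ℕ → ℝ → ι → ℝ) (x : ℕ → ℕ → ℝ) : Prop where
  piece_nonneg : ∀ σ ∈ (range (N + 1)).sigma (fun a => range (n a)), ∀ K t, |t| ≤ l₀ → ∀ τ ∈ T K, 0 ≤ shXs σ K t τ
  piece_le : ∀ σ ∈ (range (N + 1)).sigma (fun a => range (n a)), ∀ K t, |t| ≤ l₀ → ∀ τ ∈ T K, shXs σ K t τ ≤ X K t τ
  ratio : ∀ σ ∈ (range (N + 1)).sigma (fun a => range (n a)), ∀ K t, |t| ≤ l₀ →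
    ∑ τ ∈ T K, shXs σ K t τ ≤ x σ.1 K * ∑ τ ∈ T K, X K t τ

/-- **THE CONSTRUCTOR.**  Age ledgers of the two runs with the same counts `n` and ratios `x`, the factorisation
`x a K ≤ s(a) · y(K − a)` with `s, y ≥ 0` and `y` summable (the LEVEL GAIN — the missing, NOT PRINTED input), and the
union bounds for the total shell parts ⇒ the literal `T4IndicatorShell.ShellWeightBound` with weight
`K ↦ Σ_{a ≤ N} n_a · (s(a) y(K − a))` (via `T4NestedShells.shellWeightBound_of_levels`).  With age-only ratios (no `y`)
there is NO such constructor: each slot's own bound must already be summable in `K` (§2). [folklore] -/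
theorem shellWeightBound_of_ageLedger {N : ℕ} {n : ℕ → ℕ} {shAs shBs : (Σ _ : ℕ, ℕ) → ℕ → ℝ → ι → ℝ}
    {x : ℕ → ℕ → ℝ} {s y : ℕ → ℝ} {shA shB : ℕ → ℝ → ι → ℝ}
    (hLA : AgeLedger l₀ T A N n shAs x) (hLB : AgeLedger l₀ T B N n shBs x)
    (hs : ∀ a ≤ N, 0 ≤ s a) (hy0 : ∀ j, 0 ≤ y j) (hy : Summable y)
    (hx : ∀ a ≤ N, ∀ K, x a K ≤ s a * y (K - a))
    (hA0 : ∀ K t, |t| ≤ l₀ → ∀ τ ∈ T K, 0 ≤ shA K t τ) (hAle : ∀ K t, |t| ≤ l₀ → ∀ τ ∈ T K, shA K t τ ≤ A K t τ)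
    (hAu : ∀ K t, |t| ≤ l₀ → ∀ τ ∈ T K,
      shA K t τ ≤ ∑ σ ∈ (range (N + 1)).sigma (fun a => range (n a)), shAs σ K t τ)
    (hB0 : ∀ K t, |t| ≤ l₀ → ∀ τ ∈ T K, 0 ≤ shB K t τ) (hBle : ∀ K t, |t| ≤ l₀ → ∀ τ ∈ T K, shB K t τ ≤ B K t τ)
    (hBu : ∀ K t, |t| ≤ l₀ → ∀ τ ∈ T K,
      shB K t τ ≤ ∑ σ ∈ (range (N + 1)).sigma (fun a => range (n a)), shBs σ K t τ) :
    ShellWeightBound l₀ T A B shA shB (fun K => ∑ a ∈ range (N + 1), (n a : ℝ) * (s a * y (K - a))) := by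
  refine shellWeightBound_of_levels (range (N + 1)) n (w := fun a K => s a * y (K - a)) (fun σ hσ => ?_)
    hA0 hAle hAu hB0 hBle hBu
  have ha : σ.1 ≤ N := mem_range_succ_iff.1 (mem_sigma.1 hσ).1
  -- the run's total weights are non-negative on the slot's terms (from 0 ≤ piece ≤ term)
  have hAnn : ∀ K t, |t| ≤ l₀ → 0 ≤ ∑ τ ∈ T K, A K t τ := fun K t ht =>
    sum_nonneg fun τ hτ => (hLA.piece_nonneg σ hσ K t ht τ hτ).trans (hLA.piece_le σ hσ K t ht τ hτ)
  have hBnn : ∀ K t, |t| ≤ l₀ → 0 ≤ ∑ τ ∈ T K, B K t τ := fun K t ht =>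
    sum_nonneg fun τ hτ => (hLB.piece_nonneg σ hσ K t ht τ hτ).trans (hLB.piece_le σ hσ K t ht τ hτ)
  exact
    { nonneg := fun K => mul_nonneg (hs σ.1 ha) (hy0 _)
      summable := (summable_shift_tsub hy σ.1).mul_left (s σ.1)
      sh_nonneg_left := hLA.piece_nonneg σ hσ
      sh_le_left := hLA.piece_le σ hσ
      sh_nonneg_right := hLB.piece_nonneg σ hσ
      sh_le_right := hLB.piece_le σ hσ
      left := fun K t ht => (hLA.ratio σ hσ K t ht).trans
        (mul_le_mul_of_nonneg_right (hx σ.1 ha K) (hAnn K t ht))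
      right := fun K t ht => (hLB.ratio σ hσ K t ht).trans
        (mul_le_mul_of_nonneg_right (hx σ.1 ha K) (hBnn K t ht)) }

/-- Its weight is the age-ledger weight of the majorant ratios, and its total is at most `C₀(n, s) · Σ_j y(j)` up to
the off-band junk of truncated subtraction — precisely: `≤ Σ_K Σ_a n_a s(a) y(K − a)`; on the band (`y` charged only at
existing levels) the exact value is `C0 · Σ' y` (`tsum_bandMajorant`). [folklore] -/
theorem weight_eq_ageWeight {N : ℕ} (n : ℕ → ℕ) (s y : ℕ → ℝ) (K : ℕ) :
    (∑ a ∈ range (N + 1), (n a : ℝ) * (s a * y (K - a)))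
      = ageWeight N (fun a => (n a : ℝ)) (fun a K => s a * y (K - a)) K := rfl

end Constructor

/-! ## §5 The printed-shape instantiation: cube counts and lowered-threshold suppression -/

section Printed

variable {N : ℕ}

/-- CUBE COUNT (PRINTED SHAPE of the multiplicities: one small-field slot per `LM₂R`-cube of the level lattice per live
level, [Balaban1988Convergent] (2.17) p. 257 / [Balaban1989LargeFieldI] p. 178; on a fixed torus the number of
level-`(K − a)` cubes is `≤ V · Λ^a` with `V` the number of final cubes and `Λ = L^d`; the finitely many slot KINDS of
`t4/T4-XREAD-U5X15.md` §2 and their bounded number per cube are absorbed in `V`).  An inequality about the cell's own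
slot bookkeeping, not an estimate (hypothesis shape). [folklore] -/
def CubeCount (N : ℕ) (n : ℕ → ℕ) (V Λ : ℝ) : Prop := ∀ a ≤ N, (n a : ℝ) ≤ V * Λ ^ a

/-- LOWERED-THRESHOLD SUPPRESSION (NOT PRINTED as a ratio statement; NE7b species — TEMPLATE: the large-field small
factor of a region where a regularity condition fails at the lowered threshold `(1 − ρ₀)θ`, [Balaban1989LargeFieldI]
p. 193, and the per-created-region factor `exp(−p₀(g_j))` of [Balaban1989LargeFieldII] (1.79) p. 383, `j` = creation
step, i.e. indexed by AGE `a` in a run with renormalised final coupling): the per-slot shell ratio of age `a` is at most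
`exp(−p a)` for every `K`. (hypothesis shape, NOT PRINTED) [folklore] -/
def LoweredThresholdSuppression (N : ℕ) (x : ℕ → ℕ → ℝ) (p : ℕ → ℝ) : Prop :=
  ∀ a ≤ N, ∀ K, 0 ≤ x a K ∧ x a K ≤ Real.exp (-p a)

/-- THE MISSING INEQUALITY, TYPED (NOT PRINTED; this is what NE7c needs beyond the printed inputs on this route): a
LEVEL-ANCHORED GAIN — the per-slot shell ratio of age `a` at run `K` is at most `exp(−p a) · y(K − a)` with `y ≥ 0`
SUMMABLE over levels.  Candidates for `y`: the two-run width `ρ_j` of (F∞) times an anti-concentration constant (the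
sibling SHELL-MEASURE route, `T4ShellMeasure.SlotAntiConcentration`); nothing on the count × suppression route produces
one. (hypothesis shape, NOT PRINTED) [folklore] -/
def LevelGain (N : ℕ) (x : ℕ → ℕ → ℝ) (p : ℕ → ℝ) (y : ℕ → ℝ) : Prop :=
  (∀ a ≤ N, ∀ K, 0 ≤ x a K ∧ x a K ≤ Real.exp (-p a) * y (K - a)) ∧ (∀ j, 0 ≤ y j) ∧ Summable y

/-- The count × suppression constant of the printed shapes: `C₀ ≤ V · Σ_{a ≤ N} Λ^a e^{−p a}`. [folklore] -/
theorem C0_le_of_cubeCount {n : ℕ → ℕ} {V Λ : ℝ} {p : ℕ → ℝ} (hc : CubeCount N n V Λ) :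
    C0 N (fun a => (n a : ℝ)) (fun a => Real.exp (-p a))
      ≤ V * ∑ a ∈ range (N + 1), Λ ^ a * Real.exp (-p a) := by
  unfold C0
  rw [mul_sum]
  refine sum_le_sum fun a ha => ?_
  rw [← mul_assoc]
  exact mul_le_mul_of_nonneg_right (hc a (mem_range_succ_iff.1 ha)) (Real.exp_pos _).le

/-- **PRINTED INPUTS ONLY ⇒ UNIFORM, NOT SUMMABLE.**  (u) Under the cube count and the lowered-threshold suppression the
age-ledger weight is bounded by `V · Σ_{a ≤ N} Λ^a e^{−p a}` uniformly in `K` … [folklore] -/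
theorem ageWeight_le_of_printedShapes {n : ℕ → ℕ} {V Λ : ℝ} {p : ℕ → ℝ} {x : ℕ → ℕ → ℝ}
    (hc : CubeCount N n V Λ) (hsup : LoweredThresholdSuppression N x p) (K : ℕ) :
    ageWeight N (fun a => (n a : ℝ)) x K ≤ V * ∑ a ∈ range (N + 1), Λ ^ a * Real.exp (-p a) :=
  (ageWeight_le_C0 (s := fun a => Real.exp (-p a)) (fun _ _ => Nat.cast_nonneg _) (fun a ha K => (hsup a ha K).2)
    K).trans (C0_le_of_cubeCount hc)

/-- … (n) and if the suppression number is all there is at the final-scale slot — the age-`0` ratio does not fall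
below a fixed fraction `c · e^{−p 0}` of it along infinitely many `K` (no `K`-dependent input exists on this route to
make it fall) — then, with at least one final cube, the weight is NOT summable: the field `ShellWeightBound.summable`
is out of reach of the printed inputs. [folklore] -/
theorem not_summable_of_printedShapes_saturated {n : ℕ → ℕ} {p : ℕ → ℝ} {x : ℕ → ℕ → ℝ}
    (hsup : LoweredThresholdSuppression N x p) (hn0 : 1 ≤ n 0) {c : ℝ} (hc : 0 < c)
    (hsat : ∃ᶠ K in atTop, c * Real.exp (-p 0) ≤ x 0 K) :
    ¬ Summable (ageWeight N (fun a => (n a : ℝ)) x) :=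
  not_summable_ageWeight_of_frequently_le (fun _ _ => Nat.cast_nonneg _) (fun a ha K => (hsup a ha K).1)
    (Nat.zero_le N) (by exact_mod_cast hn0) (mul_pos hc (Real.exp_pos _)) hsat

/-- **WITH THE LEVEL GAIN ⇒ SUMMABLE, WITH THE EXPLICIT TOTAL.**  Cube count + level gain ⇒ the age-ledger weight is
summable and, when no slot of age `a > K` is charged, `Σ_K Wsh_K ≤ V · (Σ_{a ≤ N} Λ^a e^{−p a}) · Σ_j y(j)`. [folklore] -/
theorem summable_of_levelGain {n : ℕ → ℕ} {p : ℕ → ℝ} {x : ℕ → ℕ → ℝ} {y : ℕ → ℝ}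
    (hg : LevelGain N x p y) : Summable (ageWeight N (fun a => (n a : ℝ)) x) :=
  summable_ageWeight_of_levelGain (s := fun a => Real.exp (-p a)) (fun _ _ => Nat.cast_nonneg _)
    (fun a ha K => (hg.1 a ha K).1) (fun a ha K => (hg.1 a ha K).2) hg.2.2

/-- … and the explicit total `Σ_K Wsh_K ≤ V · (Σ_{a ≤ N} Λ^a e^{−p a}) · Σ_j y(j)` on the band. [folklore] -/
theorem tsum_le_of_levelGain {n : ℕ → ℕ} {V Λ : ℝ} {p : ℕ → ℝ} {x : ℕ → ℕ → ℝ} {y : ℕ → ℝ}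
    (hc : CubeCount N n V Λ) (hg : LevelGain N x p y) (hoff : ∀ a ≤ N, ∀ K, K < a → x a K ≤ 0) :
    ∑' K, ageWeight N (fun a => (n a : ℝ)) x K ≤ (V * ∑ a ∈ range (N + 1), Λ ^ a * Real.exp (-p a)) * ∑' j, y j :=
  (tsum_ageWeight_le_C0_mul (s := fun a => Real.exp (-p a)) (fun _ _ => Nat.cast_nonneg _)
    (fun a ha K => (hg.1 a ha K).1) hoff (fun a ha K _ => (hg.1 a ha K).2) hg.2.2).trans
    (mul_le_mul_of_nonneg_right (C0_le_of_cubeCount hc) (tsum_nonneg hg.2.1))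

end Printed

end Literature.MathematicalPhysics.QuantumFieldTheory.Balaban1983to89.T4ShellCount

end
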